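import Summits.ResolutionOfSingularities.ResolutionOfSingularities.Theorems.WeightedInvariantIota3SigmaExtDimTwo
import Summits.ResolutionOfSingularities.ResolutionOfSingularities.Theorems.WeightedInvariantIota3SigmaDescentDense
import HarnessLib

/-!
# (σ-ext)₃ IS THE DESCENT OF σ-MAXIMISING TRIPLES, and holds whenever the residue field does not grow
# (door `HypersurfaceCentreConstruction`, stmt-ResolutionOfSingularities-19897; P3 rung `stub_keyRungGrHomLE_three`, gap (σ-ext)₃)

Topic: `Summits/ResolutionOfSingularities/ResolutionOfSingularities/Theorems`. Helper for the door item `HypersurfaceCentreConstruction`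
(stmt-ResolutionOfSingularities-19897, route `WeightedInvariant`), line `local-engine` (skeleton v3.12 `7a4b52ef`), def-free.  Sequel of
`keyRungGrHomLE_three_of_sigmaExt3` (…Iota3SigmaExtDimTwo, p819524): its hypothesis (σ-ext)₃ «σ(A', φ g) = σ(A, g) for φ : A → A' local,
formally smooth, e.f.t., `𝔪_A A' = 𝔪_{A'}`, `dim A = dim A' = 3`» is cut down to the one place where it is open.

* §1 (any flat algebra of local rings with `𝔪S' = 𝔪'`) the letters from PARTIAL descent: `σ₁` needs descent of reached ADMISSIBLE triples at
  `ν = ord f` only (`sigmaRatioNat_algebraMap_eq_of_admDescent`); given the ratio tie, the LEVEL SET needs descent only of the triples AT THE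
  MAXIMAL RATIO `ν!·r₁ = σ₁·r₂` (`levelSet_algebraMap_eq_of_maxRatioDescent`); equal `σ₁` and equal level sets give equal `σ`
  (`iotaSigma_algebraMap_eq_of_levelSet_eq`).
* §2 (dimension three) the ratio tie is the tree's `JFlatEssSmooth.sigmaRatioNat_algebraMap_eq` (one-member descent, Hironaka's vertex
  preparation); `f = 0` and units reach every admissible triple on both sides.  Hence **`iotaSigma_algebraMap_eq_dim3_of_maxRatioDescent`**
  and `sigmaExt_three_of_levelDescent`: (σ-ext)₃ ⟸ **(LVL-desc)₃** «for `f ∈ 𝔪_A ∖ 0` and an admissible triple `(q; r₁, r₂)` at the maximal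
  ratio of `f` WITH `q < r₂`, a two-flag of `A'` carrying `φ f` to `(q; r₁, r₂)` yields a two-flag of `A` carrying `f` to `(q; r₁, r₂)`» —
  σ-MAXIMISER DESCENT, the open core named in SIGMA-DOOR-FINITE.md §4 (two-member descent is FALSE off the maximal ratio: memo
  O53-DESC-CEX, `f = w³ + Q(u,v)²`); the triples with `q = r₂` descend outright (`flagReaches_of_algebraMap_dim3_of_r₂_eq_q`: one-flag
  collapse + one-member descent).
* §3 **`keyRungGrHomLE_three_of_levelDescent3`** — the gap list with FIVE hypotheses: (desc-τ), (LVL-desc)₃ (`q < r₂`), GAP 2, hgame,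
  residue at powers.
* §4 (any dimension) **the residue field is the only obstruction**: if every element of `S'` is congruent modulo `𝔪'` to an element of `S`
  (`κ(S) → κ(S')` onto) then `S → S'` is DENSE (`dense_of_residue_surjective`, induction on the power: `𝔪'ⁿ = 𝔪ⁿ S'`), so σ — and every
  reached triple — descends by the tree's dense descent (…Iota3SigmaDescentDense): `iotaSigma_algebraMap_eq_of_residue_surjective`.
  So (LVL-desc)₃ is a statement about the separable residue field extension `κ → κ'` alone (e.g. `T → T(X)`, finite separable `κ'/κ`).

[OURS · L1 W4.3 · audit glue + kernel lemmas]  Replaces the role of NO printed item; NOT a statement of the manuscript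
[claim: Hironaka2017, status: under-review]; candidates stay candidates; AI work, weaker than expert review.  No definition; no axiom.

## References

* H. Hironaka, *Characteristic polyhedra of singularities*, J. Math. Kyoto Univ. 7 (1967), §3, Thm. (4.8). [Hironaka1967]
* H. Matsumura, *Commutative Ring Theory* (1987), Thm. 7.5, Thm. 8.10, Thm. 14.2. [Matsumura1987]
-/

noncomputable section

set_option linter.dupNamespace false -- mandated namespace `Summit.<Summit>.<Problem>` of this single-conjunct summit

open IsLocalRing Literature.AlgebraicGeometry.Resolution
open Summit.ResolutionOfSingularities.ResolutionOfSingularities.Theorems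
open Summit.ResolutionOfSingularities.ResolutionOfSingularities.Cruxes.HypersurfaceCentreConstruction.LocalEngine.Iota3.RatContact

namespace Summit.ResolutionOfSingularities.ResolutionOfSingularities.Cruxes.HypersurfaceCentreConstruction.LocalEngine

namespace Iota3

/-! ## §1 The letters from partial descent -/

section Partial

variable {S S' : Type} [CommRing S] [CommRing S'] [IsLocalRing S] [IsLocalRing S'] [Algebra S S']

/-- **Equal `σ₁` and equal level sets give equal `σ`.** [folklore] -/
theorem iotaSigma_algebraMap_eq_of_levelSet_eq {f : S} (htie : sigmaRatioNat (algebraMap S S' f) = sigmaRatioNat f)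
    (hlev : levelSet (algebraMap S S' f) = levelSet f) : iotaSigma S' (algebraMap S S' f) = iotaSigma S f := by
  have h1 : iotaSigmaRatio S' (algebraMap S S' f) = iotaSigmaRatio S f := by rw [iotaSigmaRatio_eq, iotaSigmaRatio_eq, htie]
  have h2 : iotaSigmaLevel S' (algebraMap S S' f) = iotaSigmaLevel S f := by
    by_cases hb : BddAbove (levelSet f) ∧ (levelSet f).Nonempty
    · rw [iotaSigmaLevel_eq S f hb, iotaSigmaLevel_eq S' _ (by rw [hlev]; exact hb)]
      unfold sigmaLevelNat
      rw [hlev]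
    · rw [iotaSigmaLevel_eq_omega0 S f hb, iotaSigmaLevel_eq_omega0 S' _ (by rw [hlev]; exact hb)]
  unfold iotaSigma
  exact (iotaLex_eq_iff iotaSigmaLevel_boundedBy S' (algebraMap S S' f) S f).mpr ⟨h1, h2⟩

variable [Module.Flat S S'] (hm : (maximalIdeal S).map (algebraMap S S') = maximalIdeal S')
include hm

/-- **`σ₁` from descent of reached ADMISSIBLE triples at `ν = ord f`.** [folklore] -/
theorem sigmaRatioNat_algebraMap_eq_of_admDescent {f : S}
    (hdesc : ∀ q r₁ r₂ : ℕ, AdmissibleTriple q r₁ r₂ → FlagReaches (algebraMap S S' f) (adicOrder f).toNat q r₁ r₂ →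
      FlagReaches f (adicOrder f).toNat q r₁ r₂) :
    sigmaRatioNat (algebraMap S S' f) = sigmaRatioNat f := by
  unfold sigmaRatioNat
  rw [adicOrder_algebraMap_eq_of_flat hm]
  congr 1
  ext m
  simp only [Set.mem_setOf_eq]
  constructor
  · rintro ⟨q, r₁, r₂, hadm, hreach, hle⟩
    exact ⟨q, r₁, r₂, hadm, hdesc q r₁ r₂ hadm hreach, hle⟩
  · rintro ⟨q, r₁, r₂, hadm, hreach, hle⟩
    exact ⟨q, r₁, r₂, hadm, hreach.algebraMap_of_flat hm, hle⟩

/-- **The level set from descent AT THE MAXIMAL RATIO** (given the ratio tie): triples with `ν!·r₁ = σ₁·r₂` only. [folklore] -/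
theorem levelSet_algebraMap_eq_of_maxRatioDescent {f : S} (htie : sigmaRatioNat (algebraMap S S' f) = sigmaRatioNat f)
    (hdesc : ∀ q r₁ r₂ : ℕ, AdmissibleTriple q r₁ r₂ → ratioScale (adicOrder f).toNat * r₁ = sigmaRatioNat f * r₂ →
      FlagReaches (algebraMap S S' f) (adicOrder f).toNat q r₁ r₂ → FlagReaches f (adicOrder f).toNat q r₁ r₂) :
    levelSet (algebraMap S S' f) = levelSet f := by
  refine le_antisymm ?_ (levelSet_subset_of_flat hm f htie)
  rintro m ⟨q, r₁, r₂, hadm, hreach, hratio, hle⟩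
  rw [adicOrder_algebraMap_eq_of_flat hm] at hreach hratio hle
  rw [htie] at hratio hle
  exact ⟨q, r₁, r₂, hadm, hdesc q r₁ r₂ hadm hratio hreach, hratio, hle⟩

/-- **`σ` from the ratio tie and max-ratio descent.** [folklore] -/
theorem iotaSigma_algebraMap_eq_of_maxRatioDescent {f : S} (htie : sigmaRatioNat (algebraMap S S' f) = sigmaRatioNat f)
    (hdesc : ∀ q r₁ r₂ : ℕ, AdmissibleTriple q r₁ r₂ → ratioScale (adicOrder f).toNat * r₁ = sigmaRatioNat f * r₂ →
      FlagReaches (algebraMap S S' f) (adicOrder f).toNat q r₁ r₂ → FlagReaches f (adicOrder f).toNat q r₁ r₂) :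
    iotaSigma S' (algebraMap S S' f) = iotaSigma S f :=
  iotaSigma_algebraMap_eq_of_levelSet_eq htie (levelSet_algebraMap_eq_of_maxRatioDescent hm htie hdesc)

end Partial

/-! ## §2 Dimension three: (σ-ext)₃ from the descent of σ-maximising triples -/

section DimThree

variable {S S' : Type} [CommRing S] [CommRing S'] [IsRegularLocalRing S] [IsRegularLocalRing S'] [Algebra S S']
  [IsLocalHom (algebraMap S S')] [Algebra.FormallySmooth S S'] [Algebra.EssFiniteType S S']

omit [IsRegularLocalRing S'] [Algebra S S'] [IsLocalHom (algebraMap S S')] [Algebra.FormallySmooth S S']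
  [Algebra.EssFiniteType S S'] in
/-- A regular local ring of dimension three has a two-flag (two members of a regular system of parameters). [cite: Matsumura1987, Thm. 14.2] -/
theorem exists_isTwoFlag_dim3 (hdim : ringKrullDim S = (3 : ℕ)) : ∃ g₁ g₂ : S, IsTwoFlag g₁ g₂ := by
  obtain ⟨x, hx, hx2⟩ : ∃ x ∈ maximalIdeal S, x ∉ maximalIdeal S ^ 2 :=
    SetLike.exists_of_lt (IsLocalRing.maximalIdeal_sq_lt_of_ringKrullDim_ne_zero (by rw [hdim]; norm_num))
  have hd3 : (maximalIdeal S).spanFinrank = 3 := spanFinrank_eq_three_of_ringKrullDim (by rw [hdim, Nat.cast_ofNat])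
  obtain ⟨z, hz, -⟩ := exists_rsop_apply_eq hd3 hx hx2 (0 : Fin 3)
  exact ⟨z 0, z 1, isTwoFlag_of_rsp hd3 z hz (i := 0) (j := 1) (by decide)⟩

omit [IsRegularLocalRing S'] [Algebra S S'] [IsLocalHom (algebraMap S S')] [Algebra.FormallySmooth S S']
  [Algebra.EssFiniteType S S'] in
/-- The degenerate reaches in dimension three: `f = 0` or `ν = 0` reaches every triple with `q > 0`. [folklore] -/
theorem flagReaches_of_eq_zero_or_dim3 (hdim : ringKrullDim S = (3 : ℕ)) {f : S} {ν q r₁ r₂ : ℕ} (hq : 0 < q)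
    (h : f = 0 ∨ ν = 0) : FlagReaches f ν q r₁ r₂ := by
  obtain ⟨g₁, g₂, hfl⟩ := exists_isTwoFlag_dim3 hdim
  refine ⟨g₁, g₂, hfl, ?_⟩
  rcases h with rfl | rfl
  · exact Ideal.zero_mem _
  · rw [mul_zero, flagContactFiltration_zero g₁ g₂ q r₁ r₂ hq]
    exact Submodule.mem_top

/-- **(σ-ext)₃ FOR ONE `f` FROM THE DESCENT OF ITS σ-MAXIMISING TRIPLES**: `φ : S → S'` local, formally smooth, e.f.t. between regular local rings
of dimension three with `𝔪_S S' = 𝔪_{S'}`; if for `f ∈ 𝔪 ∖ 0` every admissible triple at the maximal ratio of `f` reached by `φ f` upstairs is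
reached by `f` downstairs, then `σ(S', φ f) = σ(S, f)` (ratio tie: `JFlatEssSmooth.sigmaRatioNat_algebraMap_eq`). [cite: Hironaka1967, §3, Thm. (4.8)]
[OURS · L1 W4.3 · (σ-ext)₃ ⟸ (LVL-desc)₃] -/
theorem iotaSigma_algebraMap_eq_dim3_of_maxRatioDescent (h𝔪 : (maximalIdeal S).map (algebraMap S S') = maximalIdeal S')
    (hdim : ringKrullDim S = (3 : ℕ)) (hdim' : ringKrullDim S' = (3 : ℕ)) (f : S)
    (hdesc : f ≠ 0 → f ∈ maximalIdeal S → ∀ q r₁ r₂ : ℕ, AdmissibleTriple q r₁ r₂ →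
      ratioScale (adicOrder f).toNat * r₁ = sigmaRatioNat f * r₂ →
      FlagReaches (algebraMap S S' f) (adicOrder f).toNat q r₁ r₂ → FlagReaches f (adicOrder f).toNat q r₁ r₂) :
    iotaSigma S' (algebraMap S S' f) = iotaSigma S f := by
  haveI : Module.Flat S S' := IotaOrderEssSmooth.flat_of_formallySmooth_of_essFiniteType S S'
  by_cases htriv : f = 0 ∨ IsUnit f
  · have hν : f = 0 ∨ (adicOrder f).toNat = 0 :=
      htriv.imp id fun hu => by rw [(adicOrder_eq_zero_iff f).mpr hu]; rfl
    have hdesc' : ∀ q r₁ r₂ : ℕ, AdmissibleTriple q r₁ r₂ → FlagReaches (algebraMap S S' f) (adicOrder f).toNat q r₁ r₂ →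
        FlagReaches f (adicOrder f).toNat q r₁ r₂ := fun q r₁ r₂ hadm _ => flagReaches_of_eq_zero_or_dim3 hdim hadm.1 hν
    have htie := sigmaRatioNat_algebraMap_eq_of_admDescent h𝔪 hdesc'
    exact iotaSigma_algebraMap_eq_of_maxRatioDescent h𝔪 htie fun q r₁ r₂ hadm _ h => hdesc' q r₁ r₂ hadm h
  · obtain ⟨hf0, hfu⟩ := not_or.mp htriv
    have hf : f ∈ maximalIdeal S := (IsLocalRing.mem_maximalIdeal f).mpr (mem_nonunits_iff.mpr hfu)
    exact iotaSigma_algebraMap_eq_of_maxRatioDescent h𝔪 (JFlatEssSmooth.sigmaRatioNat_algebraMap_eq h𝔪 hdim hdim' hf0 hf) (hdesc hf0 hf)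

/-- **Max-ratio triples with `r₂ = q` DESCEND** (any `f ∈ 𝔪 ∖ 0`, dimension three): at `q = r₂` the two-flag filtration is the one-flag
rational filtration of the first member (`flagContactFiltration_eq_ratContactFiltration`), and one-member reaches descend
(`JFlatEssSmooth.oneFlagReaches_of_algebraMap`).  So (LVL-desc)₃ is needed only at `q < r₂`. [cite: Hironaka1967, §3, Thm. (4.8)] -/
theorem flagReaches_of_algebraMap_dim3_of_r₂_eq_q (h𝔪 : (maximalIdeal S).map (algebraMap S S') = maximalIdeal S')
    (hdim : ringKrullDim S = (3 : ℕ)) (hdim' : ringKrullDim S' = (3 : ℕ)) {f : S} (hf0 : f ≠ 0) (hf : f ∈ maximalIdeal S)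
    {q r₁ : ℕ} (hq : 0 < q) (hqr : q ≤ r₁) (h : FlagReaches (algebraMap S S' f) (adicOrder f).toNat q r₁ q) :
    FlagReaches f (adicOrder f).toNat q r₁ q :=
  JFlatEssSmooth.flagReaches_of_oneFlagReaches hdim
    (JFlatEssSmooth.oneFlagReaches_of_algebraMap h𝔪 hdim hdim' hf0 hf hq r₁ (FlagReaches.oneFlagReaches ⟨hq, le_rfl, hqr⟩ h))

/-- **(σ-ext)₃ FOR ONE `f` FROM THE DESCENT OF ITS GENUINELY TWO-MEMBER σ-MAXIMISING TRIPLES** (`q < r₂` only; `q = r₂` by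
`flagReaches_of_algebraMap_dim3_of_r₂_eq_q`). [cite: Hironaka1967, §3, Thm. (4.8)] [OURS · L1 W4.3 · (σ-ext)₃ ⟸ (LVL-desc)₃] -/
theorem iotaSigma_algebraMap_eq_dim3_of_maxRatioDescent' (h𝔪 : (maximalIdeal S).map (algebraMap S S') = maximalIdeal S')
    (hdim : ringKrullDim S = (3 : ℕ)) (hdim' : ringKrullDim S' = (3 : ℕ)) (f : S)
    (hdesc : f ≠ 0 → f ∈ maximalIdeal S → ∀ q r₁ r₂ : ℕ, AdmissibleTriple q r₁ r₂ → q < r₂ →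
      ratioScale (adicOrder f).toNat * r₁ = sigmaRatioNat f * r₂ →
      FlagReaches (algebraMap S S' f) (adicOrder f).toNat q r₁ r₂ → FlagReaches f (adicOrder f).toNat q r₁ r₂) :
    iotaSigma S' (algebraMap S S' f) = iotaSigma S f := by
  refine iotaSigma_algebraMap_eq_dim3_of_maxRatioDescent h𝔪 hdim hdim' f fun hf0 hf q r₁ r₂ hadm hratio h => ?_
  rcases hadm.2.1.eq_or_lt with heq | hlt
  · subst heq
    exact flagReaches_of_algebraMap_dim3_of_r₂_eq_q h𝔪 hdim hdim' hf0 hf hadm.1 hadm.2.2 h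
  · exact hdesc hf0 hf q r₁ r₂ hadm hlt hratio h

end DimThree

/-- **(σ-ext)₃ ⟸ (LVL-desc)₃** (descent of the genuinely two-member σ-maximising triples, `q < r₂`, at equal dimension three).
[OURS · L1 W4.3 · audit glue] -/
theorem sigmaExt_three_of_levelDescent
    (hlvl : ∀ (A A' : Type) [CommRing A] [IsRegularLocalRing A] [CommRing A'] [IsRegularLocalRing A'] [Algebra A A']
      [IsLocalHom (algebraMap A A')] [Algebra.FormallySmooth A A'] [Algebra.EssFiniteType A A'] (g : A),
      ringKrullDim A = (3 : ℕ) → ringKrullDim A' = (3 : ℕ) → (maximalIdeal A).map (algebraMap A A') = maximalIdeal A' →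
      g ≠ 0 → g ∈ maximalIdeal A → ∀ q r₁ r₂ : ℕ, AdmissibleTriple q r₁ r₂ → q < r₂ →
      ratioScale (adicOrder g).toNat * r₁ = sigmaRatioNat g * r₂ →
      FlagReaches (algebraMap A A' g) (adicOrder g).toNat q r₁ r₂ → FlagReaches g (adicOrder g).toNat q r₁ r₂) :
    ∀ (A A' : Type) [CommRing A] [IsRegularLocalRing A] [CommRing A'] [IsRegularLocalRing A'] [Algebra A A']
      [IsLocalHom (algebraMap A A')] [Algebra.FormallySmooth A A'] [Algebra.EssFiniteType A A'] (g : A),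
      ringKrullDim A = (3 : ℕ) → ringKrullDim A' = (3 : ℕ) → (maximalIdeal A).map (algebraMap A A') = maximalIdeal A' →
      iotaSigma A' (algebraMap A A' g) = iotaSigma A g :=
  fun A A' _ _ _ _ _ _ _ _ g ha hb h𝔪 => iotaSigma_algebraMap_eq_dim3_of_maxRatioDescent' h𝔪 ha hb g (hlvl A A' g ha hb h𝔪)

/-! ## §4 The residue field is the only obstruction: residue-surjective maps are dense -/

section Residue

variable {S S' : Type} [CommRing S] [CommRing S'] [IsLocalRing S] [IsLocalRing S'] [Algebra S S']
  (hm : (maximalIdeal S).map (algebraMap S S') = maximalIdeal S')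
  (hres : ∀ y : S', ∃ x : S, y - algebraMap S S' x ∈ maximalIdeal S')
include hm hres

/-- **Residue-surjective + `𝔪S' = 𝔪'` ⇒ DENSE**: every element of `S'` is congruent modulo `𝔪'ⁿ` to an element of `S` (induction on `n`:
`𝔪'ⁿ = 𝔪ⁿ·S'`, and a combination `Σ φ(mᵢ) aᵢ'` with `mᵢ ∈ 𝔪ⁿ` is `φ(Σ mᵢ aᵢ)` modulo `𝔪ⁿ𝔪'`). [cite: Matsumura1987, Thm. 8.10] -/
theorem dense_of_residue_surjective (n : ℕ) (y : S') : ∃ x : S, y - algebraMap S S' x ∈ maximalIdeal S' ^ n := by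
  induction n generalizing y with
  | zero => exact ⟨0, by rw [pow_zero, Ideal.one_eq_top]; exact Submodule.mem_top⟩
  | succ n ih =>
    obtain ⟨x, hx⟩ := ih y
    have key : ∀ z ∈ (maximalIdeal S ^ n).map (algebraMap S S'),
        ∃ w ∈ maximalIdeal S ^ n, z - algebraMap S S' w ∈ maximalIdeal S' ^ (n + 1) := by
      intro z hz
      refine Submodule.span_induction (p := fun z _ => ∃ w ∈ maximalIdeal S ^ n, z - algebraMap S S' w ∈ maximalIdeal S' ^ (n + 1))
        ?_ ?_ ?_ ?_ hz
      · rintro _ ⟨w, hw, rfl⟩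
        exact ⟨w, hw, by rw [sub_self]; exact Ideal.zero_mem _⟩
      · exact ⟨0, Ideal.zero_mem _, by rw [map_zero, sub_zero]; exact Ideal.zero_mem _⟩
      · rintro z₁ z₂ - - ⟨w₁, hw₁, h₁⟩ ⟨w₂, hw₂, h₂⟩
        refine ⟨w₁ + w₂, Ideal.add_mem _ hw₁ hw₂, ?_⟩
        have e : z₁ + z₂ - algebraMap S S' (w₁ + w₂) = (z₁ - algebraMap S S' w₁) + (z₂ - algebraMap S S' w₂) := by
          rw [map_add]; ring
        rw [e]
        exact Ideal.add_mem _ h₁ h₂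
      · rintro a z - ⟨w, hw, h⟩
        obtain ⟨b, hb⟩ := hres a
        refine ⟨b * w, Ideal.mul_mem_left _ b hw, ?_⟩
        have e : a • z - algebraMap S S' (b * w) = a * (z - algebraMap S S' w) + (a - algebraMap S S' b) * algebraMap S S' w := by
          rw [smul_eq_mul, map_mul]; ring
        rw [e]
        refine Ideal.add_mem _ (Ideal.mul_mem_left _ a h) ?_
        have hw' : algebraMap S S' w ∈ maximalIdeal S' ^ n := by
          have h1 := Ideal.mem_map_of_mem (algebraMap S S') hw
          rwa [Ideal.map_pow, hm] at h1
        rw [pow_succ']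
        exact Ideal.mul_mem_mul hb hw'
    have hx' : y - algebraMap S S' x ∈ (maximalIdeal S ^ n).map (algebraMap S S') := by rwa [Ideal.map_pow, hm]
    obtain ⟨w, -, hw⟩ := key _ hx'
    refine ⟨x + w, ?_⟩
    have e : y - algebraMap S S' (x + w) = y - algebraMap S S' x - algebraMap S S' w := by rw [map_add]; ring
    rw [e]
    exact hw

/-- **σ DESCENDS WHEN THE RESIDUE FIELD DOES NOT GROW**: for a flat algebra of local rings with `𝔪S' = 𝔪'` and `κ(S) → κ(S')` onto, every
reached triple descends and `σ(S', φ f) = σ(S, f)` (tree: dense descent). [cite: Matsumura1987, Thm. 8.10] [OURS · L1 W4.3] -/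
theorem iotaSigma_algebraMap_eq_of_residue_surjective [Module.Flat S S'] (f : S) : iotaSigma S' (algebraMap S S' f) = iotaSigma S f :=
  iotaSigma_algebraMap_eq_of_dense hm (dense_of_residue_surjective hm hres) f

/-- Reached triples descend when the residue field does not grow. [cite: Matsumura1987, Thm. 8.10] -/
theorem flagReaches_algebraMap_iff_of_residue_surjective [Module.Flat S S'] (f : S) (ν q r₁ r₂ : ℕ) :
    FlagReaches (algebraMap S S' f) ν q r₁ r₂ ↔ FlagReaches f ν q r₁ r₂ :=
  flagReaches_algebraMap_iff_of_dense hm (dense_of_residue_surjective hm hres) f ν q r₁ r₂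

end Residue

end Iota3

/-! ## §3 The gap list -/

open Iota3 in
/-- **P3 RUNG FOR THE NAMED PAIR MODULO FIVE HYPOTHESES, σ-INPUT = σ-MAXIMISER DESCENT**: (desc-τ), **(LVL-desc)₃** «along a 𝔪-preserving local
formally smooth e.f.t. `φ : A → A'` of regular local rings of dimension three, every admissible triple `(q; r₁, r₂)` with `q < r₂` at the
maximal ratio of `g ∈ 𝔪_A ∖ 0` reached by `φ g` is reached by `g`», GAP 2, hgame, the residue of the dominance word at the power positions. [OURS · L1 W4.3 · audit glue] -/
theorem keyRungGrHomLE_three_of_levelDescent3 (p : ℕ)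
    (hD : ∀ (T T' : Type) [CommRing T] [IsRegularLocalRing T] [CommRing T'] [IsRegularLocalRing T'] [Algebra T T']
      [IsLocalHom (algebraMap T T')] [Algebra.FormallySmooth T T'] [Algebra.EssFiniteType T T'] (g : T),
      ringKrullDim T' ≤ 3 → IsTiePosition T' (algebraMap T T' g) → IsTiePosition T g)
    (hlvl : ∀ (A A' : Type) [CommRing A] [IsRegularLocalRing A] [CommRing A'] [IsRegularLocalRing A'] [Algebra A A']
      [IsLocalHom (algebraMap A A')] [Algebra.FormallySmooth A A'] [Algebra.EssFiniteType A A'] (g : A),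
      ringKrullDim A = (3 : ℕ) → ringKrullDim A' = (3 : ℕ) → (maximalIdeal A).map (algebraMap A A') = maximalIdeal A' →
      g ≠ 0 → g ∈ maximalIdeal A → ∀ q r₁ r₂ : ℕ, AdmissibleTriple q r₁ r₂ → q < r₂ →
      ratioScale (adicOrder g).toNat * r₁ = sigmaRatioNat g * r₂ →
      FlagReaches (algebraMap A A' g) (adicOrder g).toNat q r₁ r₂ → FlagReaches g (adicOrder g).toNat q r₁ r₂)
    (hgap2 : ∀ (T T' : Type) [CommRing T] [IsRegularLocalRing T] [CommRing T'] [IsRegularLocalRing T'] [Algebra T T']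
      [IsLocalHom (algebraMap T T')] [Algebra.FormallySmooth T T'] [Algebra.EssFiniteType T T'] (g : T),
      ringKrullDim T' ≤ 3 → (maximalIdeal T).map (algebraMap T T') = maximalIdeal T' → ringKrullDim T = (3 : ℕ) →
      iotaEps T g = 0 → ∀ m : ℕ, jSigmaPt T' (algebraMap T T' g) m = (jSigmaPt T g m).map (algebraMap T T'))
    (hgame : CanonicalGameClauseHomLE 3 p iotaFlatT jFlatT)
    (hres : ∀ (k₀ : Type) [Field k₀] [CharP k₀ p] [PerfectField k₀]
      (S : Type) [CommRing S] [Algebra k₀ S] [Algebra.EssFiniteType k₀ S] [IsRegularLocalRing S] (f : S),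
      ringKrullDim S = (3 : ℕ) → f ≠ 0 → f ∈ (maximalIdeal S) ^ 2 →
      ContactCylinder.topStratumPrime iotaOrdEpsTau S f = maximalIdeal S → iotaEps S f ≠ 1 →
      (∃ ℓ ∈ maximalIdeal S, f ∈ Ideal.span {ℓ ^ (adicOrder f).toNat} ⊔ maximalIdeal S ^ ((adicOrder f).toNat + 1)) →
      ∀ (a b : ℕ), 0 < b →
      (∀ q' r₁' r₂' : ℕ, AdmissibleTriple q' r₁' r₂' → FlagReaches f (adicOrder f).toNat q' r₁' r₂' → r₁' * b ≤ a * r₂') →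
      ∀ (g₁ g₂ g₁' g₂' : S) (q r₁ r₂ : ℕ), AdmissibleTriple q r₁ r₂ → r₁ * b = a * r₂ → q < r₂ → r₂ < r₁ →
        IsTwoFlag g₁ g₂ → IsTwoFlag g₁' g₂' →
        f ∈ flagContactFiltration g₁ g₂ q r₁ r₂ (r₁ * (adicOrder f).toNat) →
        f ∈ flagContactFiltration g₁' g₂' q r₁ r₂ (r₁ * (adicOrder f).toNat) →
        g₂' ∈ flagContactFiltration g₁ g₂ q r₁ r₂ r₂) :
    KeyRungGrHomLE 3 p :=
  keyRungGrHomLE_three_of_sigmaExt3 p hD (sigmaExt_three_of_levelDescent hlvl) hgap2 hgame hres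

end Summit.ResolutionOfSingularities.ResolutionOfSingularities.Cruxes.HypersurfaceCentreConstruction.LocalEngine

end
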